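import Summits.QuantumFields.BalabanUV.T4Continuum.Support.ScalarCovariantGreenDecay
import Summits.QuantumFields.BalabanUV.T4Continuum.Support.SubstrateBackgroundTransporters

/-!
# T⁴ programme, SUBSTRATE (shared lattice-gauge analysis library) — THE COVARIANT SCALAR GREEN DECAY READ ON A V1 GAUGE FIELD `U`:
# `S_U = scalarOp n M a′ (transS e ι U) T` decays level-free as soon as every bond variable has `n·dist1(U(b)) ≤ α`
# (junction S-GREEN × S-VOC-1 of `substrate/SUBSTRATE-MAP.md`)

Substrate cell `b2b-balaban-substrate-*`, seat p3.  The S-GREEN chain (`ScalarCovariantCoercive` p217284 → `ScalarCovariantCTDefects` p217831 →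
`ScalarCovariantGreenDecay`) proves the level-free Combes–Thomas decay of `(scalarOp n M a′ R T)⁻¹` for transporter DATA `R : Fin d → (Tor (fine n M) →
M_o(ℂ))` with `‖n(R_μ(x) − 1)‖ ≤ α`; the S-VOC-1 dictionary (`SubstrateBackgroundTransporters`, p217365, seat p1) reads a `Setup` gauge field
`U : GaugeField P j G` through a representation `ι : G →* M_o(ℂ)` and a chart `e : Site P j ≃ Tor N` AS such data: `transS e ι U ν x = ι (U(x, x + e_ν))`.
THIS FILE is the junction, so that the NE rows quantify the decay over the BACKGROUND `U` (V1) rather than over matrices: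
 * `connS_transS_le`: if `ι` realises `dist1` (`‖ι g − 1‖ = dist1 g`, `rfl` for `GaugeGroup.ofUnitaryRep`) and every bond has `n·dist1(U(b)) ≤ α`
   (the (3.35)-TYPE axial smallness `|U(b) − 1| ≤ α·η` of [B9] p.396, as a HYPOTHESIS on `U`), then the connection of `transS e ι U` has size `≤ α`;
 * **`coercive_scalarOp_of_field`**, **`scalarOp_of_field_inv_entry_decay_explicit`**: `Coercive γ_U S_U` and
   `‖S_U⁻¹((x,α),(x′,α′))‖ ≤ (2/γ_U)·e^{−κ_U·dist_∞(x,x′)/n}` for `S_U = scalarOp n M a′ (transS e ι U) T`, `γ_U = gammaU d a′ α τ > 0`,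
   `κ_U = kappaU (card o) d a′ α τ`, any site transports with `‖T(x) − 1‖ ≤ τ` — for EVERY level `n` and torus `M` with `n·M_μ ≥ 2`;
 * the trivial background: `transS e ι 1 = 1`, so at `U = 1`, `T = 1` the free averaged operator `Δ′ ⊗ 1 = DeltaPs n M a′ ⊗ 1`
   (`ScalarCovariantLaplacian.scalarOp_one`) decays with `α = τ = 0`: **`DeltaPs_kron_inv_entry_decay`** (`γ = gammaPs d a′/2`).

HONEST FRAMING (T4-DAG p. 1).  A junction of two landed dictionaries; MODEL level (one region, global small field as a hypothesis on `U`, site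
transports `T` DATA, ℓ²-entry norms, Combes–Thomas route OURS); nothing printed is a hypothesis or a conclusion; no `def … : Prop` fact; spine 0/9
unchanged; NOT infinite volume ∕ mass gap ∕ Clay.  HONEST DEPENDENCY: continuum YM on T⁴ ⇐ BetaPertH ∧ nine spine estimates (0/9 proved);
BetaPertH ⇐ (D1) ∧ (D4) ∧ CAP+tail; G-an2-4 gates asym, D1 and NE2/3/4.  ABSOLUTE RULE kept; no `sorry`.
-/

noncomputable section

open scoped BigOperators ComplexConjugate Matrix Matrix.Norms.L2Operator Kronecker ComplexOrder

namespace Summit.QuantumFields.BalabanUV.T4Continuum.ScalarCovariantGreenOfField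

open Literature.MathematicalPhysics.QuantumFieldTheory.Balaban1983to89
open Literature.MathematicalPhysics.QuantumFieldTheory.Balaban1983to89.B5Prop11Plancherel (Tor fine unitVec)
open Literature.MathematicalPhysics.QuantumFieldTheory.Balaban1983to89.Beta.TorusG0Decay (ldist)
open Summit.QuantumFields.BalabanUV.T4Continuum
open Summit.QuantumFields.BalabanUV.T4Continuum.BlockMultiplication (siteMul)
open Summit.QuantumFields.BalabanUV.T4Continuum.ScalarAveragedPropagator (DeltaPs gammaPs)
open Summit.QuantumFields.BalabanUV.T4Continuum.ScalarCovariantLaplacian (scalarOp connS scalarOp_one)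
open Summit.QuantumFields.BalabanUV.T4Continuum.CoerciveInverseTower (Coercive)
open Summit.QuantumFields.BalabanUV.T4Continuum.ScalarCovariantCoercive (gammaU kappaU coercive_scalarOp)
open Summit.QuantumFields.BalabanUV.T4Continuum.ScalarCovariantGreenDecay (scalarOp_inv_entry_decay_explicit)
open Summit.QuantumFields.BalabanUV.T4Continuum.SubstrateBackgroundTransporters (transS transS_apply transS_one)

variable {o : Type*} [Fintype o] [DecidableEq o]
variable {P : Params} (n : ℕ) [NeZero n] (M : Fin P.d → ℕ) [hM : ∀ μ, NeZero (M μ)]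
variable {j : ℕ} (e : Site P j ≃ Tor (fine n M)) {G : Type*} [GaugeGroup G] (ι : G →* Matrix o o ℂ)

/-! ## §1 The connection of a gauge field's transporters -/

omit [NeZero n] hM in
/-- **the size letter through the dictionary**: if `ι` realises `dist1` and every bond has `n·dist1(U(b)) ≤ α`, the connection `n(R − 1)` of
`R = transS e ι U` has `‖n(R_μ(x) − 1)‖ ≤ α`. [folklore] -/
theorem connS_transS_le (hdist : ∀ g, ‖ι g - 1‖ = dist1 g) {U : GaugeField P j G} {α : ℝ}
    (hU : ∀ b : PBond P j, (n : ℝ) * dist1 (U b) ≤ α) (μ : Fin P.d) (x : Tor (fine n M)) :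
    ‖connS (fine n M) ((n : ℕ) : ℂ) (transS e ι U) μ x‖ ≤ α := by
  rw [connS, norm_smul, Complex.norm_natCast, transS_apply, hdist]
  exact hU _

omit [NeZero n] hM in
/-- at the trivial background the connection vanishes: the size letter holds with `α = 0`. [folklore] -/
theorem connS_transS_one (μ : Fin P.d) (x : Tor (fine n M)) :
    ‖connS (fine n M) ((n : ℕ) : ℂ) (transS e ι (1 : GaugeField P j G)) μ x‖ ≤ 0 := by
  rw [transS_one, connS, sub_self, smul_zero, norm_zero]

/-! ## §2 Coercivity and entry decay of `S_U` as functions of the background `U` -/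

variable {a' α τ : ℝ} {T : Tor (fine n M) → Matrix o o ℂ}

/-- **COERCIVITY OF `S_U` FOR A SMALL GAUGE FIELD**: `Coercive (gammaU P.d a′ α τ) (scalarOp n M a′ (transS e ι U) T)` whenever
`n·dist1(U(b)) ≤ α` on every bond and `‖T(x) − 1‖ ≤ τ`. [folklore] -/
theorem coercive_scalarOp_of_field (hdist : ∀ g, ‖ι g - 1‖ = dist1 g) (ha' : 0 < a') (hα : 0 ≤ α) (hτ : 0 ≤ τ)
    {U : GaugeField P j G} (hU : ∀ b : PBond P j, (n : ℝ) * dist1 (U b) ≤ α) (hT : ∀ x, ‖T x - 1‖ ≤ τ) :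
    Coercive (gammaU P.d a' α τ) (scalarOp n M a' (transS e ι U) T) :=
  coercive_scalarOp n M ha' hα hτ (connS_transS_le n M e ι hdist hU) hT

/-- **LEVEL-FREE ENTRY DECAY OF `G′(U) = S_U⁻¹` FOR A SMALL GAUGE FIELD `U`** (S-GREEN read through S-VOC-1): in the regime
`γ_U = gammaU P.d a′ α τ > 0`, for every level `n`, every torus with `n·M_μ ≥ 2`, every `U` with `n·dist1(U(b)) ≤ α` on all bonds and all site
transports with `‖T(x) − 1‖ ≤ τ`:  `‖S_U⁻¹((x,α),(x′,α′))‖ ≤ (2/γ_U)·e^{−κ_U·dist_∞(x,x′)/n}`, `κ_U = kappaU (card o) P.d a′ α τ`.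
[cite: Balaban1985BackgroundPropagators, Thm 3.1 (3.42) p.397 (first entry, entry shadow, one region; route and constants ours)] [folklore] -/
theorem scalarOp_of_field_inv_entry_decay_explicit (hdist : ∀ g, ‖ι g - 1‖ = dist1 g) (ha' : 0 < a') (hα : 0 ≤ α) (hτ : 0 ≤ τ)
    (h2 : ∀ μ, 2 ≤ fine n M μ) {U : GaugeField P j G} (hU : ∀ b : PBond P j, (n : ℝ) * dist1 (U b) ≤ α) (hT : ∀ x, ‖T x - 1‖ ≤ τ)
    (hγ : 0 < gammaU P.d a' α τ) (x x' : Tor (fine n M) × o) :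
    ‖(scalarOp n M a' (transS e ι U) T)⁻¹ x x'‖
      ≤ 2 / gammaU P.d a' α τ * Real.exp (-(kappaU (Fintype.card o) P.d a' α τ * (ldist (fine n M) x.1 x'.1 / n))) :=
  scalarOp_inv_entry_decay_explicit n M ha' hα hτ h2 (connS_transS_le n M e ι hdist hU) hT hγ x x'

/-- the same in the chart's own coordinates: sites `y, y′ : Site P j`. [folklore] -/
theorem scalarOp_of_field_inv_entry_decay_chart (hdist : ∀ g, ‖ι g - 1‖ = dist1 g) (ha' : 0 < a') (hα : 0 ≤ α) (hτ : 0 ≤ τ)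
    (h2 : ∀ μ, 2 ≤ fine n M μ) {U : GaugeField P j G} (hU : ∀ b : PBond P j, (n : ℝ) * dist1 (U b) ≤ α) (hT : ∀ x, ‖T x - 1‖ ≤ τ)
    (hγ : 0 < gammaU P.d a' α τ) (y y' : Site P j) (β β' : o) :
    ‖(scalarOp n M a' (transS e ι U) T)⁻¹ (e y, β) (e y', β')‖
      ≤ 2 / gammaU P.d a' α τ * Real.exp (-(kappaU (Fintype.card o) P.d a' α τ * (ldist (fine n M) (e y) (e y') / n))) :=
  scalarOp_of_field_inv_entry_decay_explicit n M e ι hdist ha' hα hτ h2 hU hT hγ (e y, β) (e y', β')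

/-! ## §3 The trivial background: the free averaged operator `Δ′ ⊗ 1` -/

omit hM in
/-- `gammaU d a′ 0 0 = gammaPs d a′/2`. [folklore] -/
theorem gammaU_zero (d : ℕ) (a' : ℝ) : gammaU d a' 0 0 = gammaPs d a' / 2 := by
  simp [gammaU]

/-- **ENTRY DECAY OF THE FREE AVERAGED GREEN FUNCTION `(Δ′ ⊗ 1)⁻¹`** (`Δ′ = Δ + a′Π′ = ScalarAveragedPropagator.DeltaPs`, the `U = 1`, `T = 1` case
by `scalarOp_one`): `‖(Δ′ ⊗ 1)⁻¹((x,α),(x′,α′))‖ ≤ (4/γ′)·e^{−κ·dist_∞(x,x′)/n}`, `γ′ = gammaPs d a′`, `κ = kappaU (card o) d a′ 0 0` — level-free.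
[folklore] -/
theorem DeltaPs_kron_inv_entry_decay {d : ℕ} (n : ℕ) [NeZero n] (M : Fin d → ℕ) [∀ μ, NeZero (M μ)] (ha' : 0 < a') (h2 : ∀ μ, 2 ≤ fine n M μ)
    (x x' : Tor (fine n M) × o) :
    ‖(DeltaPs n M a' ⊗ₖ (1 : Matrix o o ℂ))⁻¹ x x'‖
      ≤ 4 / gammaPs d a' * Real.exp (-(kappaU (Fintype.card o) d a' 0 0 * (ldist (fine n M) x.1 x'.1 / n))) := by
  have hγ' := (ScalarAveragedPropagator.gammaPs_pos (d := d) (a' := a')).1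
  have hγ : 0 < gammaU d a' 0 0 := by rw [gammaU_zero]; positivity
  have hR : ∀ μ y, ‖connS (fine n M) ((n : ℕ) : ℂ) (fun (_ : Fin d) (_ : Tor (fine n M)) => (1 : Matrix o o ℂ)) μ y‖ ≤ 0 := by
    intro μ y; rw [connS, sub_self, smul_zero, norm_zero]
  have hT : ∀ y : Tor (fine n M), ‖(fun _ : Tor (fine n M) => (1 : Matrix o o ℂ)) y - 1‖ ≤ 0 := fun y => by rw [sub_self, norm_zero]
  have h := scalarOp_inv_entry_decay_explicit n M ha' le_rfl le_rfl h2 hR hT hγ x x'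
  rw [scalarOp_one] at h
  refine h.trans (le_of_eq ?_)
  rw [gammaU_zero]
  ring

end Summit.QuantumFields.BalabanUV.T4Continuum.ScalarCovariantGreenOfField

end
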